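import Mathlib
import HarnessLib
import Literature.MathematicalPhysics.QuantumFieldTheory.LatticeGaugeStaticPotentialProofs
import Literature.RepresentationTheory.CompactGroups.UnitaryTrick

/-!
# Crux `FemtoCurvatureTwoPoint` (stmt-QuantumFields-9363, route `LangevinControlUV`):
# the 24 diagonal families are two profiles (RP/symmetry helper part 9)

Helper for the line `generic-step-gamma-encoding` (lead prover, `--supports stmt-QuantumFields-9363`).
After the lead's reshape the crux's all-pairs upper clause K2⁺ follows from off-axis domination (stub OA,
landed separately) and bounds on the DIAGONAL families `D^{ij}_μ(s) = Cov(P_0^{ij}, P_{s e_μ}^{ij})`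
(stub DU). This file proves, for every compact `G`, continuous `ρ`, torus `(ℤ/L)⁴` and coupling `β`,
that these 24 families (`i ≠ j` ordered, `μ : Fin 4`) are only TWO functions of `s`: the transverse
profile `Cov(P_0^{01}, P_{s e₂}^{01})` (the crux's own axis family, `μ ∉ {i, j}`) and the longitudinal
profile `Cov(P_0^{01}, P_{s e₀}^{01})` (`μ ∈ {i, j}`). Ingredients: a coordinate permutation sending
`i ↦ 0, j ↦ 1` and `μ ↦ 2` (resp. `μ ↦ 0`), the tree's hypercubic invariance
`wilsonExpectation_comp_configPerm`, and the orientation blindness of `Re tr ρ` (`plaquetteHolonomy_swap`,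
`re_trace_map_inv`). So stub DU is a statement about two one-variable profiles.
-/

noncomputable section

open MeasureTheory
open Literature.MathematicalPhysics.QuantumFieldTheory

namespace Summit.QuantumFields.YangMills.Theorems.FemtoCurvatureTwoPoint

/-- **A permutation of `Fin (n+3)` sending three distinct points to `0, 1, 2`** (product of three
transpositions). [folklore] -/
theorem exists_perm_three {n : ℕ} {a b c : Fin (n + 3)} (hab : a ≠ b) (hac : a ≠ c) (hbc : b ≠ c) :
    ∃ σ : Equiv.Perm (Fin (n + 3)), σ a = 0 ∧ σ b = 1 ∧ σ c = 2 := by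
  set τ₁ : Equiv.Perm (Fin (n + 3)) := Equiv.swap a 0 with hτ₁
  have h1a : τ₁ a = 0 := by simp [hτ₁]
  set b₁ := τ₁ b with hb₁
  have hb₁0 : b₁ ≠ 0 := by
    intro h; apply hab; exact τ₁.injective (by rw [h1a, ← hb₁, h])
  set τ₂ : Equiv.Perm (Fin (n + 3)) := Equiv.swap b₁ 1 with hτ₂
  have h2b : τ₂ b₁ = 1 := by simp [hτ₂]
  have h20 : τ₂ 0 = 0 := by
    simp only [hτ₂]
    exact Equiv.swap_apply_of_ne_of_ne hb₁0.symm (by simp)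
  set c₂ := τ₂ (τ₁ c) with hc₂
  have hc₂0 : c₂ ≠ 0 := by
    intro h
    apply hac
    have : τ₂ (τ₁ c) = τ₂ (τ₁ a) := by rw [h1a, h20]; exact h
    exact (τ₁.injective (τ₂.injective this)).symm
  have hc₂1 : c₂ ≠ 1 := by
    intro h
    apply hbc
    have : τ₂ (τ₁ c) = τ₂ (τ₁ b) := by rw [← hb₁, h2b]; exact h
    exact (τ₁.injective (τ₂.injective this)).symm
  set τ₃ : Equiv.Perm (Fin (n + 3)) := Equiv.swap c₂ 2 with hτ₃
  have h3c : τ₃ c₂ = 2 := by simp [hτ₃]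
  have h30 : τ₃ 0 = 0 := by
    simp only [hτ₃]
    exact Equiv.swap_apply_of_ne_of_ne hc₂0.symm
      (by simp [Fin.ext_iff, Nat.mod_eq_of_lt (show 2 < n + 3 by omega)])
  have h31 : τ₃ 1 = 1 := by
    simp only [hτ₃]
    exact Equiv.swap_apply_of_ne_of_ne hc₂1.symm
      (by simp [Fin.ext_iff, Nat.mod_eq_of_lt (show 2 < n + 3 by omega)])
  refine ⟨τ₁.trans (τ₂.trans τ₃), ?_, ?_, ?_⟩
  · simp only [Equiv.trans_apply, h1a, h20, h30]
  · simp only [Equiv.trans_apply, ← hb₁, h2b, h31]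
  · simp only [Equiv.trans_apply, ← hc₂, h3c]

/-- **The 24 diagonal families are two functions (hypercubic symmetry of the torus Wilson state).** For
every compact `G`, continuous `ρ`, torus `(ℤ/L)⁴`, coupling `β`, plane `(i, j)` (`i ≠ j`, any order),
direction `μ` and `s : ℕ`, the diagonal covariance `D^{ij}_μ(s) = Cov(P_0^{ij}, P_{s e_μ}^{ij})`
(`P = N − Re tr ρ(U_p)`) equals the TRANSVERSE profile `Cov(P_0^{01}, P_{s e₂}^{01})` (the crux's axis
family) when `μ ∉ {i, j}` and the LONGITUDINAL profile `Cov(P_0^{01}, P_{s e₀}^{01})` when `μ ∈ {i, j}`: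
a coordinate permutation with `i ↦ 0, j ↦ 1, μ ↦ 2` (resp. `μ ↦ 0`), tree
`wilsonExpectation_comp_configPerm`, and the orientation blindness of the real trace. Consequently the
line's stub DU (`stub_diagUpper`) is a statement about two profiles only. [folklore] -/
theorem diagFamilies_two_profiles :
    ∀ (G : Type) [Group G] [TopologicalSpace G] [IsTopologicalGroup G] [CompactSpace G]
        [MeasurableSpace G] [BorelSpace G] (N : ℕ) (ρ : G →* Matrix (Fin N) (Fin N) ℂ), Continuous ρ →
      ∀ (L : ℕ) [NeZero L] (β : ℝ)
        (P : (Fin 4 → ZMod L) → Fin 4 → Fin 4 → GaugeConfig 4 L G → ℝ)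
        (E : (GaugeConfig 4 L G → ℝ) → ℝ),
        (P = fun x i j U => (N : ℝ) - (ρ (plaquetteHolonomy U x i j)).trace.re) →
        (E = fun F => wilsonExpectation ρ β F) →
      ∀ (i j μ : Fin 4) (s : ℕ), i ≠ j →
        ((μ ≠ i ∧ μ ≠ j) →
          E (fun U => P 0 i j U * P (Pi.single μ ((s : ℕ) : ZMod L)) i j U)
            - E (P 0 i j) * E (P (Pi.single μ ((s : ℕ) : ZMod L)) i j) =
          E (fun U => P 0 0 1 U * P (Pi.single (2 : Fin 4) ((s : ℕ) : ZMod L)) 0 1 U)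
            - E (P 0 0 1) * E (P (Pi.single (2 : Fin 4) ((s : ℕ) : ZMod L)) 0 1)) ∧
        ((μ = i ∨ μ = j) →
          E (fun U => P 0 i j U * P (Pi.single μ ((s : ℕ) : ZMod L)) i j U)
            - E (P 0 i j) * E (P (Pi.single μ ((s : ℕ) : ZMod L)) i j) =
          E (fun U => P 0 0 1 U * P (Pi.single (0 : Fin 4) ((s : ℕ) : ZMod L)) 0 1 U)
            - E (P 0 0 1) * E (P (Pi.single (0 : Fin 4) ((s : ℕ) : ZMod L)) 0 1)) := by
  intro G _ _ _ _ _ _ N ρ hρ L _ β P E hP hE i j μ s hij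
  subst hP hE
  -- transport of the trace function of ANY ordered plane by a coordinate permutation `σ`
  have key : ∀ (σ : Equiv.Perm (Fin 4)) (z : Site 4 L) (a b : Fin 4) (U : GaugeConfig 4 L G),
      (ρ (plaquetteHolonomy (configPerm σ.symm U) z a b)).trace.re =
        (ρ (plaquetteHolonomy U (sitePerm σ z) (σ a) (σ b))).trace.re := fun σ z a b U => by
    rw [plaquetteHolonomy_configPerm, Equiv.symm_symm]
  have hflip : ∀ (z : Site 4 L) (U : GaugeConfig 4 L G),
      (ρ (plaquetteHolonomy U z 1 0)).trace.re = (ρ (plaquetteHolonomy U z 0 1)).trace.re :=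
    fun z U => by
      rw [plaquetteHolonomy_swap U z 0 1,
        Literature.RepresentationTheory.CompactGroups.CompactGroup.re_trace_map_inv ρ hρ]
  -- the covariance after transport by `σ` with `σ i = a₀`, `σ j = b₀`
  have transport : ∀ (σ : Equiv.Perm (Fin 4)),
      wilsonExpectation ρ β (fun U : GaugeConfig 4 L G =>
          ((N : ℝ) - (ρ (plaquetteHolonomy U 0 i j)).trace.re) *
            ((N : ℝ) - (ρ (plaquetteHolonomy U (Pi.single μ ((s : ℕ) : ZMod L)) i j)).trace.re))
        - wilsonExpectation ρ β (fun U : GaugeConfig 4 L G =>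
            (N : ℝ) - (ρ (plaquetteHolonomy U 0 i j)).trace.re)
          * wilsonExpectation ρ β (fun U : GaugeConfig 4 L G =>
            (N : ℝ) - (ρ (plaquetteHolonomy U (Pi.single μ ((s : ℕ) : ZMod L)) i j)).trace.re) =
      wilsonExpectation ρ β (fun U : GaugeConfig 4 L G =>
          ((N : ℝ) - (ρ (plaquetteHolonomy U 0 (σ i) (σ j))).trace.re) *
            ((N : ℝ) - (ρ (plaquetteHolonomy U (Pi.single (σ μ) ((s : ℕ) : ZMod L))
              (σ i) (σ j))).trace.re))
        - wilsonExpectation ρ β (fun U : GaugeConfig 4 L G =>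
            (N : ℝ) - (ρ (plaquetteHolonomy U 0 (σ i) (σ j))).trace.re)
          * wilsonExpectation ρ β (fun U : GaugeConfig 4 L G =>
            (N : ℝ) - (ρ (plaquetteHolonomy U (Pi.single (σ μ) ((s : ℕ) : ZMod L))
              (σ i) (σ j))).trace.re) := fun σ => by
    have hs0 : sitePerm σ (0 : Site 4 L) = 0 := by
      funext k; simp only [sitePerm_apply, Pi.zero_apply]
    have h1 := wilsonExpectation_comp_configPerm ρ hρ β σ.symm (fun U : GaugeConfig 4 L G =>
      ((N : ℝ) - (ρ (plaquetteHolonomy U 0 i j)).trace.re) *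
        ((N : ℝ) - (ρ (plaquetteHolonomy U (Pi.single μ ((s : ℕ) : ZMod L)) i j)).trace.re))
    have h2 := wilsonExpectation_comp_configPerm ρ hρ β σ.symm (fun U : GaugeConfig 4 L G =>
      (N : ℝ) - (ρ (plaquetteHolonomy U 0 i j)).trace.re)
    have h3 := wilsonExpectation_comp_configPerm ρ hρ β σ.symm (fun U : GaugeConfig 4 L G =>
      (N : ℝ) - (ρ (plaquetteHolonomy U (Pi.single μ ((s : ℕ) : ZMod L)) i j)).trace.re)
    simp only [Function.comp_def, key, hs0, sitePerm_single] at h1 h2 h3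
    rw [← h1, ← h2, ← h3]
  constructor
  · rintro ⟨hμi, hμj⟩
    obtain ⟨σ, h0, h1, h2⟩ := exists_perm_three (n := 1) hij (Ne.symm hμi) (Ne.symm hμj)
    rw [transport σ, h0, h1, h2]
  · rintro (rfl | rfl)
    · -- `μ = i`: any third point goes to `2`
      obtain ⟨k, hki, hkj⟩ := (show ∀ a b : Fin 4, ∃ k : Fin 4, k ≠ a ∧ k ≠ b by decide) μ j
      obtain ⟨σ, h0, h1, -⟩ := exists_perm_three (n := 1) hij (Ne.symm hki) (Ne.symm hkj)
      rw [transport σ, h0, h1]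
    · -- `μ = j`: `j ↦ 0`, `i ↦ 1`, then flip the orientation
      obtain ⟨k, hki, hkj⟩ := (show ∀ a b : Fin 4, ∃ k : Fin 4, k ≠ a ∧ k ≠ b by decide) μ i
      obtain ⟨σ, h0, h1, -⟩ := exists_perm_three (n := 1) (Ne.symm hij) (Ne.symm hki) (Ne.symm hkj)
      rw [transport σ, h0, h1]
      simp only [hflip]

end Summit.QuantumFields.YangMills.Theorems.FemtoCurvatureTwoPoint

end
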